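import Summits.AnomalousDissipation.AnomalousDissipation.Theorems.EnsembleRigidityGPStatisticalRigidityDesaturation
import Literature.Analysis.FluidPDE.CylindricalGenerator
import Literature.Analysis.FluidPDE.StatisticalSolutionProofs
import HarnessLib

/-!
# Stub `stub_symmetrise` of line `cutoff_compactness` (crux stmt-AnomalousDissipation-18402,
  `TameRoughRigidity.TameClosure`)

**Time-reversal normal form of the limit.** For a smooth force `f` on `T³`, a Borel probability
measure `μ` on `H = L²_σ(T³)` with integrable energy `≤ E`, mean enstrophy `≤ G₁` and the EXACT
cylindrical Liouville identity `∫ ⟨f − B(v,v), Φ'(v)⟩ dμ = 0` (all cylindrical `Φ`) yields a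
stationary statistical solution of the Euler equations forced by `f`, in the class of
Foias–Manley–Rosa–Temam (Ch. IV Def. 1.3), with the same bounds.

Proof. `T : v ↦ −v` is an isometric involution of `H`; the witness is the symmetrised measure
`μ' := ½ (μ + T_* μ)`. Energy, integrability and enstrophy are `T`-invariant (`‖−v‖ = ‖v‖`,
`‖∇(−v)‖² = ‖∇v‖²`, `desaturation_eGradNormSq_neg`); the Liouville identity transfers because
`⟨F₀(−v), w⟩ = ⟨F₀(v), w⟩` (the inertial term is quadratic, `desaturation_generator_neg_left`),
`⟨F₀(v), −w⟩ = −⟨F₀(v), w⟩` (`desaturation_generator_neg_right`) and every cylindrical `Φ` has a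
reflected cylindrical `TΦ` with `(TΦ)'(v) = −Φ'(−v)` (`desaturation_exists_reflect`), so that
`∫ ⟨F₀, Φ'⟩ dT_*μ = −∫ ⟨F₀, (TΦ)'⟩ dμ = 0`. Finally the work `(v, f)` is odd and every energy
shell `{e₁ ≤ |v|² < e₂}` is even, so `μ'` has ZERO work on every shell, which at viscosity
`ν = 0` is exactly the shell energy inequality (1.31) (with equality). The pattern is the landed
`stub_desaturation` (`Theorems/EnsembleRigidityGPStatisticalRigidityDesaturation.lean`).

## References

* C. Foias, O. Manley, R. Rosa, R. Temam, *Navier–Stokes Equations and Turbulence* (CUP 2001),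
  Ch. IV §1.2 Def. 1.3, (1.29)–(1.31). [FoiasManleyRosaTemam2001]
-/

set_option linter.dupNamespace false

noncomputable section

namespace Summit.AnomalousDissipation.AnomalousDissipation.Theorems.TameRoughRigidity.TameClosure

open MeasureTheory Filter Topology UnitAddTorus
open scoped InnerProductSpace RealInnerProductSpace ENNReal NNReal
open Literature.Analysis.FunctionSpaces Literature.Analysis.FluidPDE

/-- Local notation: real vector fields on `T³`. -/
local notation "Vec3" => (UnitAddTorus (Fin 3)) → (EuclideanSpace ℝ (Fin 3))
/-- Local notation: `L²(T³; ℝ³)`. -/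
local notation "L2" => (Lp (EuclideanSpace ℝ (Fin 3)) 2 (volume : Measure (UnitAddTorus (Fin 3))))
/-- Local notation: the energy space `H`. -/
local notation "H3" => (Torus.energySpace (Fin 3))

/-! ### Negation on `H`: the work functional is odd -/

/-- The work functional is odd: `(−v, g) = −(v, g)` for `g ∈ L²` (re-proved here; the copy in
the pattern file `EnsembleRigidityGPStatisticalRigidityDesaturation` is private). [folklore] -/
private theorem symmetrise_pairing_neg {g : Vec3} (hg : MemLp g 2 volume) (v : H3) :
    Torus.pairing (((-v : H3) : L2)) g = -Torus.pairing ((v : H3) : L2) g := by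
  -- adapted from `GPStatisticalRigidity.desaturation_pairing_neg`
  rw [Submodule.coe_neg, Torus.pairing_eq_inner hg, Torus.pairing_eq_inner hg, inner_neg_left]

/-! ### The stub -/

/-- **S4 `stub_symmetrise`** — TIME-REVERSAL NORMAL FORM OF THE LIMIT. For a smooth force `f`, a
Borel probability measure on `H` with integrable energy `≤ E`, mean enstrophy `≤ G₁` and the EXACT
cylindrical Liouville identity `∫ ⟨f − B(v,v), Φ'(v)⟩ dμ = 0` (all cylindrical `Φ`) yields a
stationary statistical solution of the Euler equations forced by `f` in the FMRT class with the
same bounds: the symmetrised measure `μ' = ½(μ + (v ↦ −v)_*μ)` has the same energy and enstrophy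
(`‖∇(−v)‖ = ‖∇v‖`, `desaturation_eGradNormSq_neg`), still satisfies the identity
(`⟨F₀(−v), w⟩ = ⟨F₀(v), w⟩`, `⟨F₀(v), −w⟩ = −⟨F₀(v), w⟩`, reflected test
`desaturation_exists_reflect`), has finite mean enstrophy (`≤ ofReal G₁ < ⊤`) and ZERO work
`∫_{shell} (v, f) dμ' = 0` on every energy shell (the pairing is odd, shells are even), which at
`ν = 0` is the shell energy inequality (1.31).
[FoiasManleyRosaTemam2001, Ch. IV §1.2 Def. 1.3 (1.29)–(1.31)] -/
theorem stub_symmetrise (f : Vec3) (hf : Torus.IsSmooth f) (E G₁ : ℝ) (μ : Measure H3)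
    (hprob : IsProbabilityMeasure μ) (hint : Integrable (fun v : H3 => ‖v‖ ^ 2) μ)
    (hE : Torus.ensembleEnergy μ ≤ E) (hG : Torus.ensembleEnstrophy μ ≤ ENNReal.ofReal G₁)
    (hgen : ∀ Φ : Torus.CylindricalTest (Fin 3),
      Integrable (fun v : H3 => Torus.nsGeneratorPairing 0 f v (Φ.grad v)) μ ∧
        ∫ v, Torus.nsGeneratorPairing 0 f v (Φ.grad v) ∂μ = 0) :
    ∃ μ' : Measure H3, Torus.IsStationaryStatisticalSolution 0 f μ' ∧
      Integrable (fun v : H3 => ‖v‖ ^ 2) μ' ∧ Torus.ensembleEnergy μ' ≤ E ∧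
      Torus.ensembleEnstrophy μ' ≤ ENNReal.ofReal G₁ := by
  haveI := hprob
  have hf2 : MemLp f 2 volume := hf.memLp 2
  -- the reflection `T` and the push-forward `ν = T_* μ`
  have hTa : ∀ v : H3, MeasurableEquiv.neg H3 v = -v := fun v => by simp
  set ν : Measure H3 := μ.map (MeasurableEquiv.neg H3) with hν
  haveI : IsProbabilityMeasure ν :=
    Measure.isProbabilityMeasure_map (MeasurableEquiv.neg H3).measurable.aemeasurable
  have hIν : ∀ g : H3 → ℝ, ∫ v, g v ∂ν = ∫ v, g (-v) ∂μ := fun g => by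
    rw [hν, integral_map_equiv]
    simp only [hTa]
  have hIntν : ∀ g : H3 → ℝ, Integrable (fun v => g (-v)) μ → Integrable g ν := fun g hg => by
    rw [hν]
    refine (integrable_map_equiv _ g).2 ?_
    simpa only [Function.comp_def, hTa] using hg
  -- the symmetrised measure `μ' = ½ (μ + ν)`
  set μ' : Measure H3 := (2⁻¹ : ℝ≥0∞) • (μ + ν) with hμ'
  have h2 : (2⁻¹ : ℝ≥0∞) * 2 = 1 := ENNReal.inv_mul_cancel two_ne_zero ENNReal.ofNat_ne_top
  have hprob' : IsProbabilityMeasure μ' := ⟨by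
    rw [hμ', Measure.smul_apply, Measure.add_apply, measure_univ, measure_univ, smul_eq_mul,
      one_add_one_eq_two, h2]⟩
  have hInt' : ∀ g : H3 → ℝ, Integrable g μ → Integrable g ν → Integrable g μ' :=
    fun g h1 h2 => by
    rw [hμ']
    exact (h1.add_measure h2).smul_measure (ENNReal.inv_ne_top.2 two_ne_zero)
  have hI : ∀ g : H3 → ℝ, Integrable g μ → Integrable g ν →
      ∫ v, g v ∂μ' = 2⁻¹ * ((∫ v, g v ∂μ) + ∫ v, g (-v) ∂μ) := fun g hgμ hgν => by
    rw [hμ', integral_smul_measure, integral_add_measure hgμ hgν, hIν, smul_eq_mul,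
      ENNReal.toReal_inv, ENNReal.toReal_ofNat]
  -- energy
  have hintν : Integrable (fun v : H3 => ‖v‖ ^ 2) ν :=
    hIntν _ (by simpa only [norm_neg] using hint)
  have hint' : Integrable (fun v : H3 => ‖v‖ ^ 2) μ' := hInt' _ hint hintν
  have hE' : Torus.ensembleEnergy μ' ≤ E := by
    have h1 : Torus.ensembleEnergy μ' = Torus.ensembleEnergy μ := by
      unfold Torus.ensembleEnergy
      rw [hI _ hint hintν]
      simp only [norm_neg]
      ring
    exact h1 ▸ hE
  -- enstrophy
  have hGeq : Torus.ensembleEnstrophy μ' = Torus.ensembleEnstrophy μ := by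
    unfold Torus.ensembleEnstrophy
    rw [hμ', lintegral_smul_measure, lintegral_add_measure, hν, lintegral_map_equiv]
    simp only [hTa, EnsembleRigidity.GPStatisticalRigidity.desaturation_eGradNormSq_neg,
      smul_eq_mul]
    rw [← two_mul, ← mul_assoc, h2, one_mul]
  have hG' : Torus.ensembleEnstrophy μ' ≤ ENNReal.ofReal G₁ := hGeq ▸ hG
  -- zero shell work
  have hP : Integrable (fun v : H3 => Torus.pairing (v : L2) f) μ := by
    refine Integrable.mono' ((hint.add (integrable_const 1)).const_mul ‖hf2.toLp f‖)
      (Torus.continuous_pairing_coe hf2).aestronglyMeasurable (ae_of_all _ fun v => ?_)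
    rw [Real.norm_eq_abs]
    refine (Torus.abs_pairing_coe_le hf2 v).trans ?_
    simp only [Pi.add_apply]
    nlinarith [mul_nonneg (norm_nonneg (hf2.toLp f)) (sq_nonneg (‖v‖ - 1)),
      mul_nonneg (norm_nonneg (hf2.toLp f)) (norm_nonneg v)]
  have hPν : Integrable (fun v : H3 => Torus.pairing (v : L2) f) ν :=
    hIntν _ (by simpa only [symmetrise_pairing_neg hf2] using hP.fun_neg)
  have hshell : ∀ e₁ e₂ : ℝ≥0∞, e₁ < e₂ →
      ∫ v in {v : H3 | e₁ ≤ ‖v‖ₑ ^ 2 ∧ ‖v‖ₑ ^ 2 < e₂}, Torus.pairing (v : L2) f ∂μ' = 0 := by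
    intro e₁ e₂ _
    have hpre : (MeasurableEquiv.neg H3) ⁻¹' {v : H3 | e₁ ≤ ‖v‖ₑ ^ 2 ∧ ‖v‖ₑ ^ 2 < e₂} =
        {v : H3 | e₁ ≤ ‖v‖ₑ ^ 2 ∧ ‖v‖ₑ ^ 2 < e₂} := by
      ext v
      simp only [Set.mem_preimage, Set.mem_setOf_eq, hTa, enorm_neg]
    rw [hμ', Measure.restrict_smul, Measure.restrict_add, integral_smul_measure,
      integral_add_measure hP.restrict hPν.restrict, hν, setIntegral_map_equiv, hpre]
    simp only [hTa, symmetrise_pairing_neg hf2, integral_neg, add_neg_cancel, smul_zero]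
  -- the exact Liouville identity transfers
  have hgen' : ∀ Φ : Torus.CylindricalTest (Fin 3),
      Integrable (fun v : H3 => Torus.nsGeneratorPairing 0 f v (Φ.grad v)) μ' ∧
        ∫ v, Torus.nsGeneratorPairing 0 f v (Φ.grad v) ∂μ' = 0 := by
    intro Φ
    obtain ⟨Ψ, hΨ⟩ := EnsembleRigidity.GPStatisticalRigidity.desaturation_exists_reflect Φ
    have hgn : ∀ v : H3, Torus.nsGeneratorPairing 0 f (-v) (Φ.grad (-v)) =
        -Torus.nsGeneratorPairing 0 f v (Ψ.grad v) := fun v => by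
      rw [hΨ, EnsembleRigidity.GPStatisticalRigidity.desaturation_generator_neg_right, neg_neg,
        EnsembleRigidity.GPStatisticalRigidity.desaturation_generator_neg_left]
    obtain ⟨hLμ, hzμ⟩ := hgen Φ
    obtain ⟨hLΨ, hzΨ⟩ := hgen Ψ
    have hLν : Integrable (fun v : H3 => Torus.nsGeneratorPairing 0 f v (Φ.grad v)) ν := by
      refine hIntν _ ?_
      simp_rw [hgn]
      exact hLΨ.fun_neg
    refine ⟨hInt' _ hLμ hLν, ?_⟩
    rw [hI _ hLμ hLν]
    simp_rw [hgn, integral_neg, hzμ, hzΨ]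
    norm_num
  -- assemble the FMRT stationary statistical solution
  refine ⟨μ', ⟨hprob', ?_, hgen', ?_⟩, hint', hE', hG'⟩
  · -- finite mean enstrophy
    change Torus.ensembleEnstrophy μ' < ⊤
    exact hG'.trans_lt ENNReal.ofReal_lt_top
  · -- the shell energy inequality at `ν = 0`: zero work
    intro e₁ e₂ hlt
    simp only [zero_mul, zero_sub]
    rw [integral_neg, hshell e₁ e₂ hlt, neg_zero]

end Summit.AnomalousDissipation.AnomalousDissipation.Theorems.TameRoughRigidity.TameClosure

end
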